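import Literature.NumberTheory.NumberFields.EisensteinFieldSelmerNormCubeSplit
import HarnessLib

/-!
# `K(S, 3)` of `ℚ(ζ₃)` with TWO split primes: `S = {λ} ∪ {q ∣ N inert} ∪ {ϖ₁, ϖ̄₁, ϖ₂, ϖ̄₂}`; the norm-cube classes
# are `[ζ^i (ϖ₁ϖ̄₁²)^{k₁} (ϖ₂ϖ̄₂²)^{k₂}]`

Topic `NumberTheory/NumberFields`; namespace `Literature.NumberTheory.NumberFields.K3`. Sequel to
`EisensteinFieldSelmerNormCubeSplit` (ONE split prime), adding a second rational prime `p₂ ≡ 1 (mod 3)`, `p₂ ≠ p₁`, split in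
`𝓞 K3 = ℤ[ζ]` as `p₂ = ϖ₂ϖ̄₂`, `ϖ₂ = a₂ + b₂ζ`. For the `3`-isogeny descent of Cohen–Pazuki ([CohenPazuki2009], Def. 1.3, Thm. 2.1)
on `V : y² = x³ − 3(mx + b̂)²` this is the Selmer box of the `μ₃`-kernel side when `2b̂√−3` is supported on `λ`, inert primes and
TWO split primes — the shape of most rank-3 curves with a rational `3`-torsion point and conductor `< 5·10⁵` (e.g. 216634a1:
`p₁p₂ = 43·229`; 250604a1: `31·43`; 282286c1, 447764a1: `31·157`; 310868a1: `31·109`).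
* `associated_of_prime_of_dvd_three_mul_split₂` — a prime element dividing `3Np₁p₂` is associated to `λ`, an inert `q ∣ N`,
  `ϖ₁`, `ϖ̄₁`, `ϖ₂` or `ϖ̄₂`;
* **`exists_normal_form_split₂`** — `3 ∣ ord_v(x)` for all `v ∌ 3Np₁p₂` ⇒
  `x = s ζ^i (ζ − 1)^j (∏_{q ∣ N} q^{e_q}) ϖ₁^{k₁} ϖ̄₁^{l₁} ϖ₂^{k₂} ϖ̄₂^{l₂} w³`, `s = ±1`, all exponents `< 3`;
* `norm_normalForm_split₂` — its norm is `3^j (∏ q^{2e_q}) p₁^{k₁+l₁} p₂^{k₂+l₂} N(w)³`;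
* **`exponents_of_norm_cube_split₂`** — norm a rational cube ⇒ `j = 0`, `e_q = 0`, `3 ∣ k₁ + l₁`, `3 ∣ k₂ + l₂`;
* **`exists_cubeClass_eq_of_norm_cube_split₂`** — hence `[x] = [ζ^i (ϖ₁ϖ̄₁²)^{k₁} (ϖ₂ϖ̄₂²)^{k₂}]` with `i, k₁, k₂ < 3`
  (`[ϖ²ϖ̄] = [(ϖϖ̄²)²]`): the norm-cube box is the `𝔽₃`-space `⟨[ζ], [ϖ₁ϖ̄₁²], [ϖ₂ϖ̄₂²]⟩`.

## References
* [CohenPazuki2009] H. Cohen, F. Pazuki, Acta Arith. 140 (2009), Definition 1.3 (`G₃`), Theorem 2.1.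
* [SilvermanAEC2009] J. H. Silverman, *AEC* 2nd ed., Prop. VIII.1.6 (`K(S, n)`).
* [IrelandRosen1990] K. Ireland, M. Rosen, GTM 84, Prop. 9.1.4 (primes of `ℤ[ω]`).
-/

noncomputable section

open QuadraticAlgebra NumberField IsDedekindDomain IsDedekindDomain.HeightOneSpectrum
open WithZero (log exp)
open scoped WithZero
open Literature.NumberTheory.EllipticCurves.MordellDescent (cubeClass CubeUnits cubeClass_mul
  cubeClass_neg cubeClass_mul_pow_three cubeClass_eq_cubeClass_iff cubeClass_pow_three)

namespace Literature.NumberTheory.NumberFields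

namespace K3

section Split₂

variable {N : ℕ} (hN0 : N ≠ 0) (hN : ∀ q ∈ N.primeFactors, q = 2 ∨ q % 3 = 2)
  {p₁ : ℕ} (hp₁ : p₁.Prime) (hp₁1 : p₁ % 3 = 1) {a₁ b₁ : ℤ} (hab₁ : a₁ ^ 2 - a₁ * b₁ + b₁ ^ 2 = p₁)
  {p₂ : ℕ} (hp₂ : p₂.Prime) (hp₂1 : p₂ % 3 = 1) {a₂ b₂ : ℤ} (hab₂ : a₂ ^ 2 - a₂ * b₂ + b₂ ^ 2 = p₂) (hne : p₁ ≠ p₂)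

/-! ## Prime elements dividing `3Np₁p₂` -/

include hN0 hN hp₁ hab₁ hp₂ hab₂ in
/-- **A prime element dividing `3Np₁p₂` is associated to `λ`, to an inert prime factor `q` of `N`, to `ϖ₁`, `ϖ̄₁`, `ϖ₂` or `ϖ̄₂`.**
[cite: IrelandRosen1990, Prop. 9.1.4] -/
theorem associated_of_prime_of_dvd_three_mul_split₂ {r : 𝓞 K3} (hr : Prime r)
    (h : r ∣ ((3 * N * p₁ * p₂ : ℕ) : 𝓞 K3)) :
    (Associated r lamInt ∨ (∃ q ∈ N.primeFactors, Associated r ((q : ℕ) : 𝓞 K3)) ∨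
      Associated r (mkInt a₁ b₁) ∨ Associated r (mkInt (a₁ - b₁) (-b₁))) ∨
      Associated r (mkInt a₂ b₂) ∨ Associated r (mkInt (a₂ - b₂) (-b₂)) := by
  have hsplit : ((3 * N * p₁ * p₂ : ℕ) : 𝓞 K3) = ((3 * N * p₁ : ℕ) : 𝓞 K3) * (mkInt a₂ b₂ * mkInt (a₂ - b₂) (-b₂)) := by
    rw [← natCast_eq_mkInt_mul_conj hab₂]; push_cast; ring
  rw [hsplit] at h
  rcases hr.dvd_or_dvd h with h3N | hP
  · exact Or.inl (associated_of_prime_of_dvd_three_mul_split hN0 hN hp₁ hab₁ hr h3N)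
  · rcases hr.dvd_or_dvd hP with h1 | h2
    · exact Or.inr (Or.inl (hr.irreducible.associated_of_dvd
        (prime_mkInt_of_norm_eq_prime hp₂ hab₂).irreducible h1))
    · exact Or.inr (Or.inr (hr.irreducible.associated_of_dvd
        (prime_mkInt_of_norm_eq_prime hp₂ ((norm_conj_eq a₂ b₂).trans hab₂)).irreducible h2))

include hN0 hN hp₁ hab₁ hp₂ hab₂ in
/-- Every prime element dividing `3Np₁p₂` is associated to one of the generators, as a family on
`Option N.primeFactors ⊕ (Bool ⊕ Bool)`. [folklore] -/
private theorem gensSplit₂_spec (r : 𝓞 K3) (hr : Prime r) (h : r ∣ ((3 * N * p₁ * p₂ : ℕ) : 𝓞 K3)) :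
    ∃ i : Option N.primeFactors ⊕ (Bool ⊕ Bool), Associated r
      ((fun i : Option N.primeFactors ⊕ (Bool ⊕ Bool) => Sum.elim (fun o : Option N.primeFactors => Option.elim o lamInt (fun q => ((q : ℕ) : 𝓞 K3)))
      (fun c : Bool ⊕ Bool => Sum.elim (fun c₁ : Bool => cond c₁ (mkInt a₁ b₁) (mkInt (a₁ - b₁) (-b₁)))
        (fun c₂ : Bool => cond c₂ (mkInt a₂ b₂) (mkInt (a₂ - b₂) (-b₂))) c) i) i) := by
  rcases associated_of_prime_of_dvd_three_mul_split₂ hN0 hN hp₁ hab₁ hp₂ hab₂ hr h with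
    (h | ⟨q, hq, h⟩ | h | h) | h | h
  · exact ⟨Sum.inl none, h⟩
  · exact ⟨Sum.inl (some ⟨q, hq⟩), h⟩
  · exact ⟨Sum.inr (Sum.inl true), h⟩
  · exact ⟨Sum.inr (Sum.inl false), h⟩
  · exact ⟨Sum.inr (Sum.inr true), h⟩
  · exact ⟨Sum.inr (Sum.inr false), h⟩

/-! ## The normal form -/

include hN0 hN hp₁ hab₁ hp₂ hab₂ in
/-- **Normal form of `K(S, 3)`, `S = {λ} ∪ {q ∣ N} ∪ {ϖ₁, ϖ̄₁, ϖ₂, ϖ̄₂}`** (`N`'s prime factors inert, `ϖᵢϖ̄ᵢ = pᵢ ≡ 1 (3)` split):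
if `x ∈ K3ˣ` has `3 ∣ ord_v(x)` for every finite place `v ∌ 3Np₁p₂`, then
`x = s ζ^i (ζ − 1)^j (∏_{q ∣ N} q^{e q}) ϖ₁^{k₁} ϖ̄₁^{l₁} ϖ₂^{k₂} ϖ̄₂^{l₂} w³` with `s = ±1`, all exponents `< 3`, `w ≠ 0`.
[cite: SilvermanAEC2009, Prop. VIII.1.6 (proof)] -/
theorem exists_normal_form_split₂ {x : K3} (hx : x ≠ 0)
    (hval : ∀ v : HeightOneSpectrum (𝓞 K3), ((3 * N * p₁ * p₂ : ℕ) : 𝓞 K3) ∉ v.asIdeal →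
      (3 : ℤ) ∣ log (v.valuation K3 x)) :
    ∃ (s : ℤ) (i j : ℕ) (e : ℕ → ℕ) (k₁ l₁ k₂ l₂ : ℕ) (w : K3), (s = 1 ∨ s = -1) ∧ i < 3 ∧ j < 3 ∧ (∀ q, e q < 3) ∧
      k₁ < 3 ∧ l₁ < 3 ∧ k₂ < 3 ∧ l₂ < 3 ∧ w ≠ 0 ∧
      x = s * zeta ^ i * (zeta - 1) ^ j * (∏ q ∈ N.primeFactors, (q : K3) ^ e q) *
        (⟨a₁, b₁⟩ : K3) ^ k₁ * (⟨a₁ - b₁, -b₁⟩ : K3) ^ l₁ * (⟨a₂, b₂⟩ : K3) ^ k₂ * (⟨a₂ - b₂, -b₂⟩ : K3) ^ l₂ * w ^ 3 := by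
  classical
  obtain ⟨u, e, w, he, hw, h⟩ := exists_eq_unit_mul_prod_pow_mul_pow (K := K3) ((3 * N * p₁ * p₂ : ℕ) : 𝓞 K3)
    (fun i : Option N.primeFactors ⊕ (Bool ⊕ Bool) => Sum.elim (fun o : Option N.primeFactors => Option.elim o lamInt (fun q => ((q : ℕ) : 𝓞 K3)))
      (fun c : Bool ⊕ Bool => Sum.elim (fun c₁ : Bool => cond c₁ (mkInt a₁ b₁) (mkInt (a₁ - b₁) (-b₁)))
        (fun c₂ : Bool => cond c₂ (mkInt a₂ b₂) (mkInt (a₂ - b₂) (-b₂))) c) i)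
    (gensSplit₂_spec hN0 hN hp₁ hab₁ hp₂ hab₂) (n := 3) (by norm_num) hx hval
  obtain ⟨s, i, hs, hi, hu⟩ := exists_coe_unit_eq u
  refine ⟨s, i, e (Sum.inl none), fun q => if hq : q ∈ N.primeFactors then e (Sum.inl (some ⟨q, hq⟩)) else 0,
    e (Sum.inr (Sum.inl true)), e (Sum.inr (Sum.inl false)), e (Sum.inr (Sum.inr true)), e (Sum.inr (Sum.inr false)),
    w, hs, hi, he _, fun q => ?_, he _, he _, he _, he _, hw, ?_⟩
  · by_cases hq : q ∈ N.primeFactors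
    · dsimp only; rw [dif_pos hq]; exact he _
    · dsimp only; rw [dif_neg hq]; norm_num
  · rw [h, Fintype.prod_sum_type, Fintype.prod_sum_type, Fintype.prod_option, Fintype.prod_bool, Fintype.prod_bool, hu]
    have hprod : (∏ y : N.primeFactors, (((fun i : Option N.primeFactors ⊕ (Bool ⊕ Bool) => Sum.elim (fun o : Option N.primeFactors => Option.elim o lamInt (fun q => ((q : ℕ) : 𝓞 K3)))
      (fun c : Bool ⊕ Bool => Sum.elim (fun c₁ : Bool => cond c₁ (mkInt a₁ b₁) (mkInt (a₁ - b₁) (-b₁)))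
        (fun c₂ : Bool => cond c₂ (mkInt a₂ b₂) (mkInt (a₂ - b₂) (-b₂))) c) i) (Sum.inl (some y)) : 𝓞 K3) : K3) ^ e (Sum.inl (some y))) =
        ∏ q ∈ N.primeFactors, (q : K3) ^ (if hq : q ∈ N.primeFactors then e (Sum.inl (some ⟨q, hq⟩)) else 0) := by
      rw [← Finset.prod_coe_sort N.primeFactors]
      refine Finset.prod_congr rfl fun y _ => ?_
      rw [dif_pos y.2]
      simp only [Sum.elim_inl, Option.elim]
      rw [coe_natCast_ringOfIntegers]
    rw [hprod]
    simp only [Sum.elim_inl, Sum.elim_inr, Option.elim, cond_true, cond_false, coe_lamInt, coe_mkInt]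
    push_cast
    ring

/-! ## Norms -/

include hab₁ hab₂ in
/-- **The norm of a two-split normal form**:
`N(s ζ^i (ζ−1)^j (∏ q^{e_q}) ϖ₁^{k₁} ϖ̄₁^{l₁} ϖ₂^{k₂} ϖ̄₂^{l₂} w³) = 3^j (∏ (q²)^{e_q}) p₁^{k₁+l₁} p₂^{k₂+l₂} N(w)³`.
[cite: CohenPazuki2009, Definition 1.3 (G₃) with Theorem 2.1] -/
theorem norm_normalForm_split₂ {s : ℤ} (hs : s = 1 ∨ s = -1) (i j : ℕ) (e : ℕ → ℕ) (k₁ l₁ k₂ l₂ : ℕ) (w : K3) :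
    QuadraticAlgebra.norm ((s : K3) * zeta ^ i * (zeta - 1) ^ j * (∏ q ∈ N.primeFactors, (q : K3) ^ e q) *
        (⟨a₁, b₁⟩ : K3) ^ k₁ * (⟨a₁ - b₁, -b₁⟩ : K3) ^ l₁ * (⟨a₂, b₂⟩ : K3) ^ k₂ * (⟨a₂ - b₂, -b₂⟩ : K3) ^ l₂ * w ^ 3) =
      3 ^ j * (∏ q ∈ N.primeFactors, ((q : ℚ) ^ 2) ^ e q) * (p₁ : ℚ) ^ (k₁ + l₁) * (p₂ : ℚ) ^ (k₂ + l₂) *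
        (QuadraticAlgebra.norm w) ^ 3 := by
  rw [map_mul, map_mul, map_mul, map_mul, map_mul, map_mul, map_mul, map_mul, map_pow, map_pow, map_pow, map_pow, map_pow,
    map_pow, map_pow, norm_prodPow, norm_zeta, norm_zeta_sub_one, norm_varpi hab₁, norm_varpi_conj hab₁, norm_varpi hab₂,
    norm_varpi_conj hab₂]
  have hs1 : QuadraticAlgebra.norm (s : K3) = 1 := by
    have : QuadraticAlgebra.norm ((s : ℤ) : K3) = 1 := by
      rw [norm_intCast]; rcases hs with rfl | rfl <;> norm_num
    exact_mod_cast this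
  rw [hs1, pow_add, pow_add]
  ring

/-- `N(w) ≠ 0` for `w ≠ 0` (private copy). [cite: CohenPazuki2009, Definition 1.3 (G₃)] -/
private theorem norm_ne_zero₂ {w : K3} (hw : w ≠ 0) : QuadraticAlgebra.norm w ≠ 0 := by
  intro h0
  have h := algebraMap_norm_eq_mul_star w
  rw [h0, map_zero] at h
  rcases mul_eq_zero.mp h.symm with h1 | h1
  · exact hw h1
  · exact hw (star_eq_zero.mp h1)

/-- `v_p(c) = 0` for distinct primes `p ≠ c` (bookkeeping, private). [cite: SilvermanAEC2009, Prop. VIII.1.6 (proof)] -/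
private theorem padicValRat_natCast_eq_zero_of_ne {p c : ℕ} [hp : Fact p.Prime] (hc : c.Prime) (hpc : p ≠ c) :
    padicValRat p (c : ℚ) = 0 := by
  rw [padicValRat.of_nat]
  have : padicValNat p c = 0 := padicValNat.eq_zero_of_not_dvd fun h =>
    hpc ((Nat.prime_dvd_prime_iff_eq hp.out hc).mp h)
  rw [this]; simp

/-! ## The norm-cube condition: `j = 0`, `e_q = 0`, `3 ∣ k₁ + l₁`, `3 ∣ k₂ + l₂` -/

include hN0 hN hp₁ hp₁1 hab₁ hp₂ hp₂1 hab₂ hne in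
/-- **The norm-cube condition (two split primes)**: if the norm of a two-split normal form is the cube of a rational number then
`j = 0`, `e_q = 0` for all `q ∣ N`, `3 ∣ k₁ + l₁` and `3 ∣ k₂ + l₂` — the valuations of `3^j ∏ q^{2e_q} p₁^{k₁+l₁} p₂^{k₂+l₂}` at
`3`, `q`, `p₁`, `p₂` are `j`, `2e_q`, `k₁ + l₁`, `k₂ + l₂`. [cite: CohenPazuki2009, Definition 1.3 (G₃) with Theorem 2.1] -/
theorem exponents_of_norm_cube_split₂ {s : ℤ} (hs : s = 1 ∨ s = -1) {i j : ℕ} {e : ℕ → ℕ} {k₁ l₁ k₂ l₂ : ℕ}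
    (hj : j < 3) (he : ∀ q, e q < 3) {w : K3} (hw : w ≠ 0) {r : ℚ}
    (hr : QuadraticAlgebra.norm ((s : K3) * zeta ^ i * (zeta - 1) ^ j *
      (∏ q ∈ N.primeFactors, (q : K3) ^ e q) * (⟨a₁, b₁⟩ : K3) ^ k₁ * (⟨a₁ - b₁, -b₁⟩ : K3) ^ l₁ *
        (⟨a₂, b₂⟩ : K3) ^ k₂ * (⟨a₂ - b₂, -b₂⟩ : K3) ^ l₂ * w ^ 3) = r ^ 3) :
    j = 0 ∧ (∀ q ∈ N.primeFactors, e q = 0) ∧ 3 ∣ k₁ + l₁ ∧ 3 ∣ k₂ + l₂ := by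
  haveI : Fact (Nat.Prime 3) := ⟨Nat.prime_three⟩
  haveI : Fact p₁.Prime := ⟨hp₁⟩
  haveI : Fact p₂.Prime := ⟨hp₂⟩
  rw [norm_normalForm_split₂ hab₁ hab₂ hs] at hr
  have hNw := norm_ne_zero₂ hw
  set Nw := QuadraticAlgebra.norm w with hNwdef
  have hprimes : ∀ q ∈ N.primeFactors, q.Prime := fun q hq => Nat.prime_of_mem_primeFactors hq
  have hp10 : (p₁ : ℚ) ≠ 0 := Nat.cast_ne_zero.mpr hp₁.ne_zero
  have hp20 : (p₂ : ℚ) ≠ 0 := Nat.cast_ne_zero.mpr hp₂.ne_zero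
  have hP : (∏ q ∈ N.primeFactors, ((q : ℚ) ^ 2) ^ e q) ≠ 0 :=
    Finset.prod_ne_zero_iff.mpr fun q hq => pow_ne_zero _ (pow_ne_zero _ (Nat.cast_ne_zero.mpr (hprimes q hq).ne_zero))
  -- the rational part `A = 3^j ∏ q^{2e_q} p₁^{k₁+l₁} p₂^{k₂+l₂}`
  set A := (3 : ℚ) ^ j * (∏ q ∈ N.primeFactors, ((q : ℚ) ^ 2) ^ e q) * (p₁ : ℚ) ^ (k₁ + l₁) * (p₂ : ℚ) ^ (k₂ + l₂)
    with hAdef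
  have hA : A ≠ 0 :=
    mul_ne_zero (mul_ne_zero (mul_ne_zero (pow_ne_zero _ (by norm_num)) hP) (pow_ne_zero _ hp10)) (pow_ne_zero _ hp20)
  have hr0 : r ≠ 0 := by
    rintro rfl
    rw [zero_pow three_ne_zero] at hr
    exact (mul_ne_zero hA (pow_ne_zero 3 hNw)) hr
  have key : A = (r / Nw) ^ 3 := by
    rw [div_pow, eq_div_iff (pow_ne_zero 3 hNw), hr]
  have h3N : (3 : ℕ) ∉ N.primeFactors := fun h => not_three_dvd_of_mem_primeFactors hN0 hN h (dvd_refl 3)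
  have hp1N : p₁ ∉ N.primeFactors := fun h => by rcases hN p₁ h with h2 | h2 <;> omega
  have hp2N : p₂ ∉ N.primeFactors := fun h => by rcases hN p₂ h with h2 | h2 <;> omega
  have hp13 : p₁ ≠ 3 := fun h => by omega
  have hp23 : p₂ ≠ 3 := fun h => by omega
  have e3 : (3 : ℚ) = ((3 : ℕ) : ℚ) := by norm_num
  -- the valuation of `A` at a prime `c`: additivity
  have vA : ∀ (c : ℕ) [Fact c.Prime], padicValRat c A = padicValRat c ((3 : ℚ) ^ j) +
      padicValRat c (∏ q ∈ N.primeFactors, ((q : ℚ) ^ 2) ^ e q) + padicValRat c ((p₁ : ℚ) ^ (k₁ + l₁)) +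
      padicValRat c ((p₂ : ℚ) ^ (k₂ + l₂)) := by
    intro c _
    rw [hAdef, padicValRat.mul (mul_ne_zero (mul_ne_zero (pow_ne_zero _ (by norm_num)) hP) (pow_ne_zero _ hp10))
      (pow_ne_zero _ hp20), padicValRat.mul (mul_ne_zero (pow_ne_zero _ (by norm_num)) hP) (pow_ne_zero _ hp10),
      padicValRat.mul (pow_ne_zero _ (by norm_num)) hP]
  have dA : ∀ (c : ℕ) [Fact c.Prime], (3 : ℤ) ∣ padicValRat c A := fun c _ =>
    ⟨padicValRat c (r / Nw), by rw [key, padicValRat.pow]; ring⟩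
  -- valuation at `3`: `j`
  have v3 : padicValRat 3 A = j := by
    rw [vA 3, padicValRat.pow, padicValRat.pow, padicValRat.pow, e3, padicValRat.self (by norm_num),
      padicValRat_prodPow_sq 3 _ hprimes, if_neg h3N, padicValRat_natCast_eq_zero_of_ne hp₁ (Ne.symm hp13),
      padicValRat_natCast_eq_zero_of_ne hp₂ (Ne.symm hp23)]
    ring
  have d3 : (3 : ℤ) ∣ (j : ℤ) := v3 ▸ dA 3
  -- valuation at `p₁`: `k₁ + l₁`
  have vp1 : padicValRat p₁ A = ((k₁ + l₁ : ℕ) : ℤ) := by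
    rw [vA p₁, padicValRat.pow, padicValRat.pow, padicValRat.pow, e3, padicValRat_natCast_eq_zero_of_ne Nat.prime_three hp13,
      padicValRat_prodPow_sq p₁ _ hprimes, if_neg hp1N, padicValRat.self hp₁.one_lt,
      padicValRat_natCast_eq_zero_of_ne hp₂ hne]
    push_cast; ring
  have dp1 : (3 : ℤ) ∣ ((k₁ + l₁ : ℕ) : ℤ) := vp1 ▸ dA p₁
  -- valuation at `p₂`: `k₂ + l₂`
  have vp2 : padicValRat p₂ A = ((k₂ + l₂ : ℕ) : ℤ) := by
    rw [vA p₂, padicValRat.pow, padicValRat.pow, padicValRat.pow, e3, padicValRat_natCast_eq_zero_of_ne Nat.prime_three hp23,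
      padicValRat_prodPow_sq p₂ _ hprimes, if_neg hp2N, padicValRat_natCast_eq_zero_of_ne hp₁ (Ne.symm hne),
      padicValRat.self hp₂.one_lt]
    push_cast; ring
  have dp2 : (3 : ℤ) ∣ ((k₂ + l₂ : ℕ) : ℤ) := vp2 ▸ dA p₂
  refine ⟨by omega, fun q₀ hq₀ => ?_, by omega, by omega⟩
  -- valuation at an inert `q₀ ∣ N`: `2 e_{q₀}`
  haveI : Fact q₀.Prime := ⟨hprimes q₀ hq₀⟩
  have hq3 : q₀ ≠ 3 := fun h => h3N (h ▸ hq₀)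
  have hq1 : q₀ ≠ p₁ := fun h => hp1N (h ▸ hq₀)
  have hq2 : q₀ ≠ p₂ := fun h => hp2N (h ▸ hq₀)
  have vq : padicValRat q₀ A = 2 * (e q₀ : ℤ) := by
    rw [vA q₀, padicValRat.pow, padicValRat.pow, padicValRat.pow, e3, padicValRat_natCast_eq_zero_of_ne Nat.prime_three hq3,
      padicValRat_prodPow_sq q₀ _ hprimes, if_pos hq₀, padicValRat_natCast_eq_zero_of_ne hp₁ hq1,
      padicValRat_natCast_eq_zero_of_ne hp₂ hq2]
    ring
  have dq : (3 : ℤ) ∣ 2 * (e q₀ : ℤ) := vq ▸ dA q₀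
  have := he q₀
  omega

/-! ## The norm-cube box with two split primes -/

/-- `ϖ ≠ 0` in `K3` when `a² − ab + b² = p` is prime (bookkeeping, private). [cite: IrelandRosen1990, Prop. 9.1.4] -/
private theorem varpi_ne_zero {p : ℕ} (hp : p.Prime) {a b : ℤ} (hab : a ^ 2 - a * b + b ^ 2 = p) : (⟨a, b⟩ : K3) ≠ 0 := by
  intro h0
  have hp0 : (p : ℤ) ≠ 0 := by exact_mod_cast hp.ne_zero
  have ha : (a : ℚ) = 0 := congrArg QuadraticAlgebra.re h0
  have hb : (b : ℚ) = 0 := congrArg QuadraticAlgebra.im h0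
  have ha' : a = 0 := by exact_mod_cast ha
  have hb' : b = 0 := by exact_mod_cast hb
  subst ha'; subst hb'
  exact hp0 (by rw [← hab]; ring)

/-- `ϖ̄ ≠ 0` in `K3` when `a² − ab + b² = p` is prime (bookkeeping, private). [cite: IrelandRosen1990, Prop. 9.1.4] -/
private theorem varpi_conj_ne_zero {p : ℕ} (hp : p.Prime) {a b : ℤ} (hab : a ^ 2 - a * b + b ^ 2 = p) :
    (⟨a - b, -b⟩ : K3) ≠ 0 := by
  have h := varpi_ne_zero hp ((norm_conj_eq a b).trans hab)
  intro h0; apply h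
  have e : (⟨((a - b : ℤ) : ℚ), ((-b : ℤ) : ℚ)⟩ : K3) = ⟨(a : ℚ) - b, -b⟩ := by push_cast; rfl
  rw [e]; exact h0

/-- **`[X ϖ^k ϖ̄^l] = [X (ϖϖ̄²)^k]` for `(k, l) ∈ {(0,0), (1,2), (2,1)}`** (`ϖ²ϖ̄ · ϖ̄³ = (ϖϖ̄²)²`).
[cite: CohenPazuki2009, Definition 1.3] -/
theorem cubeClass_mul_varpi_pow_eq {x y X : K3} (hx : x ≠ 0) (hy : y ≠ 0) (hX : X ≠ 0) {k l : ℕ}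
    (hkl : k = 0 ∧ l = 0 ∨ k = 1 ∧ l = 2 ∨ k = 2 ∧ l = 1) :
    cubeClass (X * x ^ k * y ^ l) = cubeClass (X * (x * y ^ 2) ^ k) := by
  rcases hkl with ⟨rfl, rfl⟩ | ⟨rfl, rfl⟩ | ⟨rfl, rfl⟩
  · simp
  · rw [pow_one, pow_one, mul_assoc]
  · rw [show X * (x * y ^ 2) ^ 2 = X * x ^ 2 * y ^ 1 * y ^ 3 by ring,
      cubeClass_mul_pow_three (mul_ne_zero (mul_ne_zero hX (pow_ne_zero _ hx)) (pow_ne_zero _ hy)) hy]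

include hN0 hN hp₁ hp₁1 hab₁ hp₂ hp₂1 hab₂ hne in
/-- **`G₃ ∩ K(S, 3)` for `S = {λ} ∪ {q ∣ N inert} ∪ {ϖ₁, ϖ̄₁, ϖ₂, ϖ̄₂}`**: an element `x ∈ K3ˣ` with `3 ∣ ord_v(x)` for every finite
place `v ∌ 3Np₁p₂` and whose norm is a rational cube has cube class `[ζ^i (ϖ₁ϖ̄₁²)^{k₁} (ϖ₂ϖ̄₂²)^{k₂}]` with `i, k₁, k₂ < 3`: the
norm-cube box is the `𝔽₃`-space spanned by `[ζ]`, `[ϖ₁ϖ̄₁²]`, `[ϖ₂ϖ̄₂²]`. [cite: CohenPazuki2009, Definition 1.3 and Theorem 2.1] -/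
theorem exists_cubeClass_eq_of_norm_cube_split₂ {x : K3} (hx : x ≠ 0)
    (hval : ∀ v : HeightOneSpectrum (𝓞 K3), ((3 * N * p₁ * p₂ : ℕ) : 𝓞 K3) ∉ v.asIdeal →
      (3 : ℤ) ∣ log (v.valuation K3 x))
    (hnorm : ∃ r : ℚ, QuadraticAlgebra.norm x = r ^ 3) :
    ∃ i k₁ k₂ : ℕ, i < 3 ∧ k₁ < 3 ∧ k₂ < 3 ∧
      cubeClass x = cubeClass (zeta ^ i * ((⟨a₁, b₁⟩ : K3) * (⟨a₁ - b₁, -b₁⟩ : K3) ^ 2) ^ k₁ *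
        ((⟨a₂, b₂⟩ : K3) * (⟨a₂ - b₂, -b₂⟩ : K3) ^ 2) ^ k₂) := by
  obtain ⟨s, i, j, e, k₁, l₁, k₂, l₂, w, hs, hi, hj, he, hk₁, hl₁, hk₂, hl₂, hw, hx_eq⟩ :=
    exists_normal_form_split₂ hN0 hN hp₁ hab₁ hp₂ hab₂ hx hval
  obtain ⟨r, hr⟩ := hnorm
  rw [hx_eq] at hr
  obtain ⟨rfl, he0, hkl₁, hkl₂⟩ := exponents_of_norm_cube_split₂ hN0 hN hp₁ hp₁1 hab₁ hp₂ hp₂1 hab₂ hne hs hj he hw hr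
  refine ⟨i, k₁, k₂, hi, hk₁, hk₂, ?_⟩
  have hprod : (∏ q ∈ N.primeFactors, (q : K3) ^ e q) = 1 :=
    Finset.prod_eq_one fun q hq => by rw [he0 q hq, pow_zero]
  have hz : (zeta : K3) ≠ 0 := isPrimitiveRoot_zeta.ne_zero (by norm_num)
  have hs0 : (s : K3) ≠ 0 := by rcases hs with rfl | rfl <;> norm_num
  have hϖ₁ := varpi_ne_zero hp₁ hab₁
  have hϖ₁' := varpi_conj_ne_zero hp₁ hab₁
  have hϖ₂ := varpi_ne_zero hp₂ hab₂
  have hϖ₂' := varpi_conj_ne_zero hp₂ hab₂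
  have hkl₁' : k₁ = 0 ∧ l₁ = 0 ∨ k₁ = 1 ∧ l₁ = 2 ∨ k₁ = 2 ∧ l₁ = 1 := by omega
  have hkl₂' : k₂ = 0 ∧ l₂ = 0 ∨ k₂ = 1 ∧ l₂ = 2 ∨ k₂ = 2 ∧ l₂ = 1 := by omega
  -- strip the sign and the cube, then convert `ϖᵢ^{kᵢ} ϖ̄ᵢ^{lᵢ}` to `(ϖᵢϖ̄ᵢ²)^{kᵢ}`
  have hX₁ : (zeta : K3) ^ i ≠ 0 := pow_ne_zero _ hz
  have hcore₁ : (zeta : K3) ^ i * (⟨a₁, b₁⟩ : K3) ^ k₁ * (⟨a₁ - b₁, -b₁⟩ : K3) ^ l₁ ≠ 0 :=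
    mul_ne_zero (mul_ne_zero hX₁ (pow_ne_zero _ hϖ₁)) (pow_ne_zero _ hϖ₁')
  have hcore : (zeta : K3) ^ i * (⟨a₁, b₁⟩ : K3) ^ k₁ * (⟨a₁ - b₁, -b₁⟩ : K3) ^ l₁ * (⟨a₂, b₂⟩ : K3) ^ k₂ *
      (⟨a₂ - b₂, -b₂⟩ : K3) ^ l₂ ≠ 0 :=
    mul_ne_zero (mul_ne_zero hcore₁ (pow_ne_zero _ hϖ₂)) (pow_ne_zero _ hϖ₂')
  have hY : (s : K3) * (zeta : K3) ^ i * (⟨a₁, b₁⟩ : K3) ^ k₁ * (⟨a₁ - b₁, -b₁⟩ : K3) ^ l₁ * (⟨a₂, b₂⟩ : K3) ^ k₂ *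
      (⟨a₂ - b₂, -b₂⟩ : K3) ^ l₂ ≠ 0 :=
    mul_ne_zero (mul_ne_zero (mul_ne_zero (mul_ne_zero (mul_ne_zero hs0 hX₁) (pow_ne_zero _ hϖ₁))
      (pow_ne_zero _ hϖ₁')) (pow_ne_zero _ hϖ₂)) (pow_ne_zero _ hϖ₂')
  have step0 : cubeClass x = cubeClass ((zeta : K3) ^ i * (⟨a₁, b₁⟩ : K3) ^ k₁ * (⟨a₁ - b₁, -b₁⟩ : K3) ^ l₁ *
      (⟨a₂, b₂⟩ : K3) ^ k₂ * (⟨a₂ - b₂, -b₂⟩ : K3) ^ l₂) := by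
    rw [hx_eq, hprod, pow_zero, mul_one, mul_one, cubeClass_mul_pow_three hY hw]
    rcases hs with rfl | rfl
    · push_cast; rw [one_mul]
    · push_cast
      rw [show (-1 : K3) * zeta ^ i * (⟨a₁, b₁⟩ : K3) ^ k₁ * (⟨a₁ - b₁, -b₁⟩ : K3) ^ l₁ * (⟨a₂, b₂⟩ : K3) ^ k₂ *
          (⟨a₂ - b₂, -b₂⟩ : K3) ^ l₂ = -((zeta : K3) ^ i * (⟨a₁, b₁⟩ : K3) ^ k₁ * (⟨a₁ - b₁, -b₁⟩ : K3) ^ l₁ *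
          (⟨a₂, b₂⟩ : K3) ^ k₂ * (⟨a₂ - b₂, -b₂⟩ : K3) ^ l₂) by ring, cubeClass_neg]
  have step2 : cubeClass ((zeta : K3) ^ i * (⟨a₁, b₁⟩ : K3) ^ k₁ * (⟨a₁ - b₁, -b₁⟩ : K3) ^ l₁ *
      (⟨a₂, b₂⟩ : K3) ^ k₂ * (⟨a₂ - b₂, -b₂⟩ : K3) ^ l₂) =
      cubeClass ((zeta : K3) ^ i * (⟨a₁, b₁⟩ : K3) ^ k₁ * (⟨a₁ - b₁, -b₁⟩ : K3) ^ l₁ *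
        ((⟨a₂, b₂⟩ : K3) * (⟨a₂ - b₂, -b₂⟩ : K3) ^ 2) ^ k₂) :=
    cubeClass_mul_varpi_pow_eq hϖ₂ hϖ₂' hcore₁ hkl₂'
  have hg₂ : ((⟨a₂, b₂⟩ : K3) * (⟨a₂ - b₂, -b₂⟩ : K3) ^ 2) ^ k₂ ≠ 0 :=
    pow_ne_zero _ (mul_ne_zero hϖ₂ (pow_ne_zero _ hϖ₂'))
  have step1 : cubeClass ((zeta : K3) ^ i * (⟨a₁, b₁⟩ : K3) ^ k₁ * (⟨a₁ - b₁, -b₁⟩ : K3) ^ l₁ *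
        ((⟨a₂, b₂⟩ : K3) * (⟨a₂ - b₂, -b₂⟩ : K3) ^ 2) ^ k₂) =
      cubeClass ((zeta : K3) ^ i * ((⟨a₁, b₁⟩ : K3) * (⟨a₁ - b₁, -b₁⟩ : K3) ^ 2) ^ k₁ *
        ((⟨a₂, b₂⟩ : K3) * (⟨a₂ - b₂, -b₂⟩ : K3) ^ 2) ^ k₂) := by
    have h := cubeClass_mul_varpi_pow_eq hϖ₁ hϖ₁' (mul_ne_zero hX₁ hg₂) hkl₁'
      (X := (zeta : K3) ^ i * ((⟨a₂, b₂⟩ : K3) * (⟨a₂ - b₂, -b₂⟩ : K3) ^ 2) ^ k₂)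
    rw [show (zeta : K3) ^ i * (⟨a₁, b₁⟩ : K3) ^ k₁ * (⟨a₁ - b₁, -b₁⟩ : K3) ^ l₁ *
        ((⟨a₂, b₂⟩ : K3) * (⟨a₂ - b₂, -b₂⟩ : K3) ^ 2) ^ k₂ =
        (zeta : K3) ^ i * ((⟨a₂, b₂⟩ : K3) * (⟨a₂ - b₂, -b₂⟩ : K3) ^ 2) ^ k₂ * (⟨a₁, b₁⟩ : K3) ^ k₁ *
          (⟨a₁ - b₁, -b₁⟩ : K3) ^ l₁ by ring, h]
    congr 1; ring
  rw [step0, step2, step1]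

end Split₂

end K3

end Literature.NumberTheory.NumberFields
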